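import Summits.QuantumFields.YangMills.Theorems.UnitScaleTiltProp7SymAvgGLBridge
import Summits.QuantumFields.YangMills.Theorems.UnitScaleTiltProp8ChartCovariance
import Literature.MathematicalPhysics.QuantumFieldTheory.Balaban1983to89.B7TransferAnalyticMean
import HarnessLib

/-!
# `UnitScaleTiltProp7QSymGaugeCovariance` — THE COVARIANCE CLASS OF THE (AVG-SYM) CORE (OWNER RULING g26-№1 Σ-TWIST, item (2)): the route's complexified symmetric descent is EXACTLY gauge
# covariant under EVERY `GL₂(ℂ)`-valued gauge transformation — `D̄_GL(V^{û})(c) = û(x̂₋)·D̄_GL(V)(c)·û(x̂₊)⁻¹` with `x̂±` the block centres of `c±` ([Balaban1985Averaging] (11), `Prop8Chart.emlIterU_gaugeActT`) —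
# hence its linearisation `QSym U₀ := fderiv (logChartSym U₀) 0` maps a FINE gauge direction `D_{U₀}λ` to the COARSE gauge direction of the CENTRE VALUES: **`QSym U₀ (D_{U₀}λ) = D_{Ū₀}(λ↓)`**
# («pinned» covariance: `λ↓ = λ ∘ centres`), for every `λ : sites → M₂(ℂ)` — the identity of FINDING w5-3 §1 that separates the core from print's restricted class (`QTw(D_{U₀}λ) = D_{Ū₀}(Q′λ)`)
# (route `UnitScaleTilt`, crux K1 «MinimiserStabilityRegPr» stmt-QuantumFields-19200, stub `stub_existenceMinimalOrbit` (EX), route (α), (AVG-SYM); def-free, count-neutral)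

Cell `ym3-torus` (HUMAN RULING D-0037, YM ladder rung R3 — YM₃ on T³ is a rung, not d = 4, not a mass gap, not Clay), width seat `ym-ust-20520-w5` (gen 3).

THE PRINT.  [Balaban1985Averaging] p. 19 (11): «Ū^u = (Ū)^u» (covariance of the averaging under gauge transformations «u coinciding with v at points of the new lattice» (12)); p. 28: «If we make a
small gauge transformation v = e^{iλ}, then a good approximation of this transformation acting on Lie algebra variables A is given by A^λ_b = A_b − (R_{0,b}λ(b₊) − λ(b₋)) = A_b − (D_{V₀}λ)(b)».
[Balaban1985RegularSpaces] p. 80: «The allowed gauge transformations u are restricted by the conditions (1.14): u(y) = 1, y ∈ 𝔅_k» (the pinned class).  [Balaban1987RG1] (0.4)–(0.7) p. 253.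

WHAT IS PROVED (sorry-free, no definition; `M₂ = Matrix (Fin 2) (Fin 2) ℂ`, GL-valued gauge transformations `û : sites → M₂ˣ`, centres `x̂(y) := embIter (K−n) (siteShift y)` of the comparison
sites — `T3PrintedRegularOrbits.descTransf u y = u (x̂ y)`):
* §1 ★**`descendToGL_gaugeActT`** — `D̄_GL(V^{û})(c) = û(x̂ c₋)·D̄_GL(V)(c)·û(x̂ c₊)⁻¹` (exact, every `û`, every `V`); `rel_gaugeActT` — the argument of `logChartSym` for the chart parameter of a pure
  gauge: `D̄_GL(U₀♭^{û})(c)·D̄_GL(U₀♭)(c)⁻¹ = û(x̂c₋)·Ū₀(c)·û(x̂c₊)⁻¹·Ū₀(c)⁻¹`.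
* §2 the gauge curve `g_t(x) = e^{tλ(x)}` (`t ∈ ℂ`), its chart parameter `A_t(b) = log(g_t(b₋)U₀(b)g_t(b₊)⁻¹U₀(b)⁻¹)` and the derivatives at `t = 0`: `hasDerivAt_conjCurve` (`d/dt [e^{tX}Me^{−tY}M⁻¹]₀ = X −
  MYM⁻¹`), `hasDerivAt_mlog_conjCurve`, `eventually_norm_conjCurve_sub_one_lt`, `expUnit_chartCurve_eventually` (`e^{A_t}U₀♭ = U₀♭^{g_t}` for `t` near `0`).
* §3 ★★★**`QSym_gaugeDir`** — if `logChartSym U₀` is differentiable at `0` (DISPLAYED: `DifferentiableAt ℂ (logChartSym F n K h U₀) 0`; supplier ★w4-20520 g2's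
  `Prop7CmapSymInputs.inputs_CmapSym` ∕ `Prop7SymAvgRelativeDiff`), then for EVERY `λ : Site → M₂`:
  `QSym U₀ (b ↦ λ(b₋) − U₀(b)λ(b₊)U₀(b)⁻¹) = (c ↦ λ(x̂c₋) − Ū₀(c)λ(x̂c₊)Ū₀(c)⁻¹)`.
HONEST FRAMING.  Exact identities + one-variable calculus; the differentiability of the log-chart is displayed; nothing of print is asserted.  `--supports stmt-QuantumFields-19200 --as helper`.

References: T. Bałaban, CMP 98 (1985) 17–51 [Balaban1985Averaging] ((8) p.19, (11)–(12) p.19, p.28); CMP 99 (1985) 75–102 [Balaban1985RegularSpaces] (p.80, (1.14) p.78); CMP 109 (1987) 249–301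
[Balaban1987RG1] ((0.4)–(0.7), (0.11) p.253); CMP 102 (1985) 277–309 [Balaban1985Variational] ((44) p.285).
-/

set_option autoImplicit false

noncomputable section

open scoped Matrix.Norms.L2Operator Topology

namespace Summit.QuantumFields.YangMills.Theorems.Prop7QSymGaugeCovariance

open NormedSpace Filter
open Literature.MathematicalPhysics.QuantumFieldTheory.Balaban1983to89
open Literature.MathematicalPhysics.QuantumFieldTheory.Balaban1983to89.T3ContinuumYM3Torus
open T4Continuum (transfUp)
open T3LevelShift (siteShift fieldShift bondShift bondShift_tgt)
open T3PrintedRegularOrbits (sites_eq)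
open T3SectALandauChart (bgUnits)
open B15DeterminingSets (embIter)
open B7Prop1Explicit (expUnit val_expUnit val_inv_expUnit)
open B10Eq27TorusAxialLog (gaugeActT gaugeActT_apply)
open MatrixLog (mlog mlog_one exp_mlog)
open B7TransferAnalyticMean (hasFDerivAt_mlog_one)
open Summit.QuantumFields.YangMills.Theorems.Prop8Chart (emlIterU emlIterU_gaugeActT)
open Summit.QuantumFields.YangMills.Theorems.Prop7SymAvgGL (descendToGL logChartSym QSym descendToGL_eq_fieldShift_emlIterU logChartSym_zero expUnit_zero_mul_bgUnits)

variable (F : T3Family) {n K : ℕ} (h : n ≤ K)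

/-! ## §1 Exact `GL₂(ℂ)` covariance of the complexified descent -/

/-- ★ **`D̄_GL(V^{û})(c) = û(x̂c₋)·D̄_GL(V)(c)·û(x̂c₊)⁻¹`** for EVERY `GL₂(ℂ)`-valued gauge transformation `û` — [Balaban1985Averaging] (11) iterated `K − n` times (`Prop8Chart.emlIterU_gaugeActT` at the family
`transfUp û`) and read on the comparison lattice (`descendToGL = fieldShift ∘ emlIterU`); `x̂ y = embIter (K−n) (siteShift y)` (`transfUp û (K−n) (siteShift y) = û (x̂ y)`, `Prop7FlatHolonomy.transfUp_eq_embIter`).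
[cite: Balaban1985Averaging, (11)–(12) p.19; Balaban1987RG1, (0.11) p.253] -/
theorem descendToGL_gaugeActT (û : GaugeTransf (F.P K) 0 (Matrix (Fin 2) (Fin 2) ℂ)ˣ) (V : GaugeField (F.P K) 0 (Matrix (Fin 2) (Fin 2) ℂ)ˣ) (c : PBond (F.P n) 0) :
    descendToGL F n K h (gaugeActT û V) c
      = transfUp û (K - n) (siteShift (sites_eq F n K h) c.src) * descendToGL F n K h V c * (transfUp û (K - n) (siteShift (sites_eq F n K h) c.tgt))⁻¹ := by
  have hus : ∀ (i : ℕ) (y : Site (F.P K) (i + 1)), transfUp û (i + 1) y = transfUp û i (emb y) := fun _ _ => rfl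
  have key : ∀ e : PBond (F.P K) (K - n),
      emlIterU (K - n) (gaugeActT û V) e = transfUp û (K - n) e.src * emlIterU (K - n) V e * (transfUp û (K - n) e.tgt)⁻¹ := fun e => by
    rw [show gaugeActT û V = gaugeActT (transfUp û 0) V from rfl, emlIterU_gaugeActT (transfUp û) hus V (K - n), gaugeActT_apply]
  rw [descendToGL_eq_fieldShift_emlIterU, descendToGL_eq_fieldShift_emlIterU, T3LevelShift.fieldShift_apply, T3LevelShift.fieldShift_apply]
  refine (key _).trans ?_
  erw [bondShift_tgt]
  rfl

/-- **THE RELATIVE DESCENDED PURE GAUGE**: `D̄_GL(U₀♭^{û})(c)·D̄_GL(U₀♭)(c)⁻¹ = û(x̂c₋)·Ū₀(c)·û(x̂c₊)⁻¹·Ū₀(c)⁻¹` (`Ū₀ := D̄_GL(U₀♭)`).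
[cite: Balaban1985Averaging, (11) p.19; Balaban1985Variational, (44) p.285] -/
theorem rel_gaugeActT (û : GaugeTransf (F.P K) 0 (Matrix (Fin 2) (Fin 2) ℂ)ˣ) (V : GaugeField (F.P K) 0 (Matrix (Fin 2) (Fin 2) ℂ)ˣ) (c : PBond (F.P n) 0) :
    ((descendToGL F n K h (gaugeActT û V) c : (Matrix (Fin 2) (Fin 2) ℂ)ˣ) : Matrix (Fin 2) (Fin 2) ℂ) * (((descendToGL F n K h V c)⁻¹ : (Matrix (Fin 2) (Fin 2) ℂ)ˣ) : Matrix (Fin 2) (Fin 2) ℂ)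
      = ((transfUp û (K - n) (siteShift (sites_eq F n K h) c.src) : (Matrix (Fin 2) (Fin 2) ℂ)ˣ) : Matrix (Fin 2) (Fin 2) ℂ)
          * ((descendToGL F n K h V c : (Matrix (Fin 2) (Fin 2) ℂ)ˣ) : Matrix (Fin 2) (Fin 2) ℂ)
          * (((transfUp û (K - n) (siteShift (sites_eq F n K h) c.tgt))⁻¹ : (Matrix (Fin 2) (Fin 2) ℂ)ˣ) : Matrix (Fin 2) (Fin 2) ℂ)
          * (((descendToGL F n K h V c)⁻¹ : (Matrix (Fin 2) (Fin 2) ℂ)ˣ) : Matrix (Fin 2) (Fin 2) ℂ) := by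
  rw [descendToGL_gaugeActT]; simp only [Units.val_mul]

/-! ## §2 The gauge curve `g_t = e^{tλ}` and its chart parameter -/

/-- **`d/dt [e^{tX}·M·e^{−tY}·N]|₀ = X·M·N − M·Y·N`** in a complete normed algebra (`t ∈ ℂ`). [folklore] -/
theorem hasDerivAt_conjCurve {𝔸 : Type*} [NormedRing 𝔸] [NormedAlgebra ℂ 𝔸] [CompleteSpace 𝔸] (X Y M N : 𝔸) :
    HasDerivAt (fun t : ℂ => exp (t • X) * M * exp (t • (-Y)) * N) (X * M * N - M * Y * N) 0 := by
  have h1 : HasDerivAt (fun t : ℂ => exp (t • X)) X 0 := by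
    simpa using hasDerivAt_exp_smul_const' (𝕂 := ℂ) X (0 : ℂ)
  have h2 : HasDerivAt (fun t : ℂ => exp (t • (-Y))) (-Y) 0 := by
    simpa using hasDerivAt_exp_smul_const' (𝕂 := ℂ) (-Y) (0 : ℂ)
  have h3 := ((h1.mul_const M).mul h2).mul_const N
  simp only [zero_smul, exp_zero, one_mul, mul_one] at h3
  have h4 : HasDerivAt (fun t : ℂ => exp (t • X) * M * exp (t • (-Y)) * N) ((X * M + M * -Y) * N) 0 := h3
  exact h4.congr_deriv (by noncomm_ring)

/-- `e^{0·X}·M·e^{0·(−Y)}·N = M·N`. [folklore] -/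
theorem conjCurve_zero {𝔸 : Type*} [NormedRing 𝔸] [NormedAlgebra ℂ 𝔸] [CompleteSpace 𝔸] (X Y M N : 𝔸) :
    exp ((0 : ℂ) • X) * M * exp ((0 : ℂ) • (-Y)) * N = M * N := by
  simp only [zero_smul, exp_zero, one_mul, mul_one]

/-- **`d/dt log[e^{tX}·M·e^{−tY}·M⁻¹]|₀ = X − M·Y·M⁻¹`** (`M` a unit; `log′(1) = id`). [cite: Balaban1985Averaging, p.28, (21)–(27) p.22] -/
theorem hasDerivAt_mlog_conjCurve {𝔸 : Type*} [NormedRing 𝔸] [NormedAlgebra ℂ 𝔸] [CompleteSpace 𝔸] (X Y : 𝔸) (M : 𝔸ˣ) :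
    HasDerivAt (fun t : ℂ => mlog (exp (t • X) * (M : 𝔸) * exp (t • (-Y)) * ((M⁻¹ : 𝔸ˣ) : 𝔸))) (X - (M : 𝔸) * Y * ((M⁻¹ : 𝔸ˣ) : 𝔸)) 0 := by
  have hc := hasDerivAt_conjCurve X Y (M : 𝔸) ((M⁻¹ : 𝔸ˣ) : 𝔸)
  have h0 : exp ((0 : ℂ) • X) * (M : 𝔸) * exp ((0 : ℂ) • (-Y)) * ((M⁻¹ : 𝔸ˣ) : 𝔸) = 1 := by rw [conjCurve_zero, Units.mul_inv]
  have hm : HasFDerivAt (mlog : 𝔸 → 𝔸) (1 : 𝔸 →L[ℂ] 𝔸) (exp ((0 : ℂ) • X) * (M : 𝔸) * exp ((0 : ℂ) • (-Y)) * ((M⁻¹ : 𝔸ˣ) : 𝔸)) := by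
    rw [h0]; exact hasFDerivAt_mlog_one
  have h := hm.comp_hasDerivAt (0 : ℂ) hc
  have h' : HasDerivAt (fun t : ℂ => mlog (exp (t • X) * (M : 𝔸) * exp (t • (-Y)) * ((M⁻¹ : 𝔸ˣ) : 𝔸)))
      ((1 : 𝔸 →L[ℂ] 𝔸) (X * (M : 𝔸) * ((M⁻¹ : 𝔸ˣ) : 𝔸) - (M : 𝔸) * Y * ((M⁻¹ : 𝔸ˣ) : 𝔸))) 0 := h
  refine h'.congr_deriv ?_
  show X * (M : 𝔸) * ((M⁻¹ : 𝔸ˣ) : 𝔸) - (M : 𝔸) * Y * ((M⁻¹ : 𝔸ˣ) : 𝔸) = _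
  rw [Units.mul_inv_cancel_right]

/-- The conjugation curve is continuous, hence within the `log` window near `t = 0`: `∀ᶠ t, ‖e^{tX}Me^{−tY}M⁻¹ − 1‖ < 1`. [folklore] -/
theorem eventually_norm_conjCurve_sub_one_lt {𝔸 : Type*} [NormedRing 𝔸] [NormedAlgebra ℂ 𝔸] [CompleteSpace 𝔸] (X Y : 𝔸) (M : 𝔸ˣ) :
    ∀ᶠ t : ℂ in 𝓝 0, ‖exp (t • X) * (M : 𝔸) * exp (t • (-Y)) * ((M⁻¹ : 𝔸ˣ) : 𝔸) - 1‖ < 1 := by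
  letI : NormedAlgebra ℚ 𝔸 := NormedAlgebra.restrictScalars ℚ ℂ 𝔸
  have hc : Continuous fun t : ℂ => exp (t • X) * (M : 𝔸) * exp (t • (-Y)) * ((M⁻¹ : 𝔸ˣ) : 𝔸) :=
    (((exp_continuous.comp (continuous_id.smul continuous_const)).mul continuous_const).mul
      (exp_continuous.comp (continuous_id.smul continuous_const))).mul continuous_const
  have h0 : (fun t : ℂ => exp (t • X) * (M : 𝔸) * exp (t • (-Y)) * ((M⁻¹ : 𝔸ˣ) : 𝔸)) 0 = 1 := by
    show exp ((0 : ℂ) • X) * (M : 𝔸) * exp ((0 : ℂ) • (-Y)) * ((M⁻¹ : 𝔸ˣ) : 𝔸) = 1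
    rw [conjCurve_zero, Units.mul_inv]
  have ht : Tendsto (fun t : ℂ => exp (t • X) * (M : 𝔸) * exp (t • (-Y)) * ((M⁻¹ : 𝔸ˣ) : 𝔸)) (𝓝 0) (𝓝 1) := by
    rw [← h0]; exact hc.continuousAt
  have hball : Metric.ball (1 : 𝔸) 1 ∈ 𝓝 (1 : 𝔸) := Metric.ball_mem_nhds 1 one_pos
  filter_upwards [ht hball] with t hmem
  rwa [Set.mem_preimage, Metric.mem_ball, dist_eq_norm] at hmem

variable {F h}

/-- **THE CHART PARAMETER OF THE GAUGE CURVE**: with `g_t(x) := e^{tλ(x)}` (`t ∈ ℂ`, `λ : sites → M₂`) and `A_t(b) := log(g_t(b₋)·U₀(b)·g_t(b₊)⁻¹·U₀(b)⁻¹)`, for `t` near `0` the chart configuration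
`e^{A_t}·U₀♭` IS the gauge transform `U₀♭^{g_t}` (`exp ∘ log = id` on the window). [cite: Balaban1985Averaging, (8) p.19, p.28] -/
theorem expUnit_chartCurve_eventually (U₀ : GaugeField (F.P K) 0 (Matrix.specialUnitaryGroup (Fin 2) ℂ)) (lam : Site (F.P K) 0 → Matrix (Fin 2) (Fin 2) ℂ) :
    ∀ᶠ t : ℂ in 𝓝 0,
      (fun b : PBond (F.P K) 0 => expUnit (mlog (exp (t • lam b.src) * ((bgUnits F K U₀ b : (Matrix (Fin 2) (Fin 2) ℂ)ˣ) : Matrix (Fin 2) (Fin 2) ℂ)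
          * exp (t • (-lam b.tgt)) * (((bgUnits F K U₀ b)⁻¹ : (Matrix (Fin 2) (Fin 2) ℂ)ˣ) : Matrix (Fin 2) (Fin 2) ℂ))) * bgUnits F K U₀ b)
        = gaugeActT (fun x => expUnit (t • lam x)) (bgUnits F K U₀) := by
  have hall : ∀ᶠ t : ℂ in 𝓝 0, ∀ b : PBond (F.P K) 0,
      ‖exp (t • lam b.src) * ((bgUnits F K U₀ b : (Matrix (Fin 2) (Fin 2) ℂ)ˣ) : Matrix (Fin 2) (Fin 2) ℂ) * exp (t • (-lam b.tgt))
          * (((bgUnits F K U₀ b)⁻¹ : (Matrix (Fin 2) (Fin 2) ℂ)ˣ) : Matrix (Fin 2) (Fin 2) ℂ) - 1‖ < 1 :=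
    eventually_all.2 fun b => eventually_norm_conjCurve_sub_one_lt (lam b.src) (lam b.tgt) (bgUnits F K U₀ b)
  filter_upwards [hall] with t ht
  funext b
  apply Units.ext
  rw [Units.val_mul, val_expUnit, exp_mlog (ht b), gaugeActT_apply, Units.val_mul, Units.val_mul, val_inv_expUnit, val_expUnit, val_expUnit,
    Units.inv_mul_cancel_right, smul_neg]

/-! ## §3 `QSym` on gauge directions: the PINNED covariance of the (AVG-SYM) core -/

/-- ★★★ **`QSym U₀ (D_{U₀}λ) = D_{Ū₀}(λ↓)` — THE (AVG-SYM) CORE IS PINNED-COVARIANT**: for EVERY `λ : sites → M₂(ℂ)`, the symmetric linearised average of the fine gauge direction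
`(D_{U₀}λ)(b) = λ(b₋) − U₀(b)λ(b₊)U₀(b)⁻¹` is the coarse gauge direction of the CENTRE VALUES, `λ(x̂c₋) − Ū₀(c)λ(x̂c₊)Ū₀(c)⁻¹` (`x̂ y = embIter (K−n) (siteShift y)`, `Ū₀ = D̄_GL(U₀♭)`) — differentiate §1 along the
gauge curve of §2 and use the chain rule (`QSym = fderiv (logChartSym U₀) 0`, differentiability DISPLAYED).  Contrast: print's `Q(U₀) = QTw U₀` sends `D_{U₀}λ` to `D_{Ū₀}(Q′(U₀)λ)` with the AVERAGED
parameter `Q′λ` ([Balaban1985BackgroundPropagators] (3.19); FINDING w5-3 §1). [cite: Balaban1985Averaging, (11) p.19, p.28; Balaban1985RegularSpaces, p.80; Balaban1987RG1, (0.11) p.253] -/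
theorem QSym_gaugeDir (U₀ : GaugeField (F.P K) 0 (Matrix.specialUnitaryGroup (Fin 2) ℂ)) (hS : DifferentiableAt ℂ (logChartSym F n K h U₀) 0)
    (lam : Site (F.P K) 0 → Matrix (Fin 2) (Fin 2) ℂ) :
    QSym F n K h U₀ (fun b : PBond (F.P K) 0 =>
        lam b.src - ((bgUnits F K U₀ b : (Matrix (Fin 2) (Fin 2) ℂ)ˣ) : Matrix (Fin 2) (Fin 2) ℂ) * lam b.tgt
          * (((bgUnits F K U₀ b)⁻¹ : (Matrix (Fin 2) (Fin 2) ℂ)ˣ) : Matrix (Fin 2) (Fin 2) ℂ))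
      = fun c : PBond (F.P n) 0 =>
        lam (embIter (K - n) (siteShift (sites_eq F n K h) c.src))
          - ((descendToGL F n K h (bgUnits F K U₀) c : (Matrix (Fin 2) (Fin 2) ℂ)ˣ) : Matrix (Fin 2) (Fin 2) ℂ) * lam (embIter (K - n) (siteShift (sites_eq F n K h) c.tgt))
            * (((descendToGL F n K h (bgUnits F K U₀) c)⁻¹ : (Matrix (Fin 2) (Fin 2) ℂ)ˣ) : Matrix (Fin 2) (Fin 2) ℂ) := by
  -- the chart parameter of the gauge curve and its derivative at 0
  set A : ℂ → PBond (F.P K) 0 → Matrix (Fin 2) (Fin 2) ℂ := fun t b =>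
    mlog (exp (t • lam b.src) * ((bgUnits F K U₀ b : (Matrix (Fin 2) (Fin 2) ℂ)ˣ) : Matrix (Fin 2) (Fin 2) ℂ) * exp (t • (-lam b.tgt))
      * (((bgUnits F K U₀ b)⁻¹ : (Matrix (Fin 2) (Fin 2) ℂ)ˣ) : Matrix (Fin 2) (Fin 2) ℂ)) with hA
  have hA0 : A 0 = 0 := by
    funext b
    show mlog (exp ((0 : ℂ) • lam b.src) * _ * exp ((0 : ℂ) • (-lam b.tgt)) * _) = 0
    rw [conjCurve_zero, Units.mul_inv, mlog_one]
  have hA' : HasDerivAt A (fun b : PBond (F.P K) 0 =>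
      lam b.src - ((bgUnits F K U₀ b : (Matrix (Fin 2) (Fin 2) ℂ)ˣ) : Matrix (Fin 2) (Fin 2) ℂ) * lam b.tgt
        * (((bgUnits F K U₀ b)⁻¹ : (Matrix (Fin 2) (Fin 2) ℂ)ˣ) : Matrix (Fin 2) (Fin 2) ℂ)) 0 := by
    rw [hasDerivAt_pi]
    intro b
    exact hasDerivAt_mlog_conjCurve (lam b.src) (lam b.tgt) (bgUnits F K U₀ b)
  -- the chain rule through the log-chart
  have hQ : HasFDerivAt (logChartSym F n K h U₀) (QSym F n K h U₀) (A 0) := by rw [hA0]; exact hS.hasFDerivAt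
  have hchain : HasDerivAt (fun t => logChartSym F n K h U₀ (A t)) (QSym F n K h U₀ (fun b : PBond (F.P K) 0 =>
      lam b.src - ((bgUnits F K U₀ b : (Matrix (Fin 2) (Fin 2) ℂ)ˣ) : Matrix (Fin 2) (Fin 2) ℂ) * lam b.tgt
        * (((bgUnits F K U₀ b)⁻¹ : (Matrix (Fin 2) (Fin 2) ℂ)ˣ) : Matrix (Fin 2) (Fin 2) ℂ))) 0 :=
    hQ.comp_hasDerivAt (0 : ℂ) hA'
  -- the explicit value of the log-chart along the gauge curve, near t = 0 (covariance §1)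
  set ψ : ℂ → PBond (F.P n) 0 → Matrix (Fin 2) (Fin 2) ℂ := fun t c =>
    mlog (exp (t • lam (embIter (K - n) (siteShift (sites_eq F n K h) c.src)))
      * ((descendToGL F n K h (bgUnits F K U₀) c : (Matrix (Fin 2) (Fin 2) ℂ)ˣ) : Matrix (Fin 2) (Fin 2) ℂ)
      * exp (t • (-lam (embIter (K - n) (siteShift (sites_eq F n K h) c.tgt))))
      * (((descendToGL F n K h (bgUnits F K U₀) c)⁻¹ : (Matrix (Fin 2) (Fin 2) ℂ)ˣ) : Matrix (Fin 2) (Fin 2) ℂ)) with hψ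
  have hψ' : HasDerivAt ψ (fun c : PBond (F.P n) 0 =>
      lam (embIter (K - n) (siteShift (sites_eq F n K h) c.src))
        - ((descendToGL F n K h (bgUnits F K U₀) c : (Matrix (Fin 2) (Fin 2) ℂ)ˣ) : Matrix (Fin 2) (Fin 2) ℂ) * lam (embIter (K - n) (siteShift (sites_eq F n K h) c.tgt))
          * (((descendToGL F n K h (bgUnits F K U₀) c)⁻¹ : (Matrix (Fin 2) (Fin 2) ℂ)ˣ) : Matrix (Fin 2) (Fin 2) ℂ)) 0 := by
    rw [hasDerivAt_pi]
    intro c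
    exact hasDerivAt_mlog_conjCurve _ _ (descendToGL F n K h (bgUnits F K U₀) c)
  have hev : (fun t => logChartSym F n K h U₀ (A t)) =ᶠ[𝓝 0] ψ := by
    filter_upwards [expUnit_chartCurve_eventually (F := F) U₀ lam] with t ht
    funext c
    show mlog (((descendToGL F n K h (fun b => expUnit (A t b) * bgUnits F K U₀ b) c : (Matrix (Fin 2) (Fin 2) ℂ)ˣ) : Matrix (Fin 2) (Fin 2) ℂ)
        * (((descendToGL F n K h (bgUnits F K U₀) c)⁻¹ : (Matrix (Fin 2) (Fin 2) ℂ)ˣ) : Matrix (Fin 2) (Fin 2) ℂ)) = ψ t c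
    rw [show (fun b => expUnit (A t b) * bgUnits F K U₀ b) = gaugeActT (fun x => expUnit (t • lam x)) (bgUnits F K U₀) from ht,
      rel_gaugeActT, hψ]
    simp only [Prop7FlatHolonomy.transfUp_eq_embIter, val_expUnit, val_inv_expUnit, smul_neg]
  exact (hchain.congr_of_eventuallyEq hev.symm).unique hψ'

end Summit.QuantumFields.YangMills.Theorems.Prop7QSymGaugeCovariance

end
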